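import Summits.CriticalPhenomena.PercolationContinuityZ3.Theorems.PercNearOneGluingNoHeavyLowerTailTformLightStarInductionOpenChampion
import HarnessLib

/-!
# `NoHeavyLowerTail` (stmt-CriticalPhenomena-4575) — the light-star induction on NON-RELAY SETS (open recursion)

Support file (prover `prim-hp-5`, hull-port cell, T-form calculus, gen 7; `--supports stmt-CriticalPhenomena-4575`).  No definitions,
no named facts, no sorries.  `μ = prodBernoulli w` on `Fin n`, relays `A`, level `j`, `π(x)` = relays joined to `x`, `π(B) = ⋃_{y ∈ B} π(y)`,
`Φ(x) = μ{|π(x)| ≤ j}`, champion `q` (`Φ(a) ≤ Φ(q)`, `a ∈ A`).  LIGHT-STAR PACKING at a non-relay set `B`, witness `q`, fallback relay `c`: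
    LSP(w, q, c, B):  `μ(q ≁ B, 1 ≤ |π(B)| ≤ j) + μ(|π(B)| = 0, |π(c)| ≤ j) ≤ μ(q ≁ B, |π(q)| ≤ j)`
(`q` is a T-witness of the glued set `B`; for `B = {o}` it is the attached-champion inequality XZ⁺ at the observer `o`).
`Theorems.xzDeficit_induction_open` proves XZ⁺ by induction on the number of positive pairs, leaving the packing inequality at LIGHT
MULTI-STARS as hypothesis, with access to XZ⁺ (= LSP at singletons) below.  Here the same induction is run on the stronger statement
"LSP at every champion for EVERY nonempty non-relay set" (outer induction on positive pairs, inner on `|B|`): `|B| = 1` is the deficit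
star-packing transfer (`Theorems.starPacking_deficit`) with reference a champion of `u = w − o`, whose per-star inputs LSP(u, p, c, S) come
from the induction hypothesis for EVERY star size; a set with a member no lighter than `q` is `CutObserver.unguardedStability_of_member`;
a LIGHT set with `|B| ≥ 2` is the hypothesis `hGlue`, which receives LSP at champions for all non-relay sets of all graphs with fewer
positive pairs (e.g. every champion of `w − y` is a T-witness of every glued star of `w − y`: the input of a reference transfer one level
down) and for all smaller sets at the same number of positive pairs.
* `lspSet_induction_open` — the induction (corollaries for the stub and the crux: file `…TformSetInductionChampion`).
-/

noncomputable section

namespace Summit.CriticalPhenomena.PercolationContinuityZ3.Theorems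

open MeasureTheory Set Literature.Probability.LatticeModels Literature.Probability.Percolation
open scoped Classical BigOperators

open CutObserver KNPreFKG in
/-- **THE LIGHT-STAR INDUCTION ON NON-RELAY SETS (open recursion).**  Let `C` be a class of weighted relay-graphs closed under
deleting the pairs at a vertex.  Assume the GLUING STEP on `C`: for `w ∈ C`, a champion `q`, a relay `c` and a set `B` of at least two
non-relay vertices each strictly lighter than `q` (`Φ(q) < μ(|π(y)| ≤ j)`), LSP(w, q, c, B) holds — GIVEN LSP at champions for every
nonempty non-relay set of every graph of `C` with fewer positive pairs, and for every smaller set of every graph of `C` with at most as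
many positive pairs.  Then LSP(w, q, c, B) holds for every `w ∈ C`, champion `q`, relay `c` and nonempty non-relay set `B`.
[cite: VandenbergHaggstromKahn2005, Thm. 1.5 (p. 7); KozmaNitzan2024, Lemma 5 (p. 13)] -/
theorem lspSet_induction_open
    (C : (n : ℕ) → (Sym2 (Fin n) → unitInterval) → Finset (Fin n) → Prop)
    (hC : ∀ (n : ℕ) (w : Sym2 (Fin n) → unitInterval) (A : Finset (Fin n)) (o : Fin n),
      C n w A → C n (fun e => if e ∈ {e : Sym2 (Fin n) | o ∉ e} then w e else 0) A)
    (hGlue : ∀ (n : ℕ) (w : Sym2 (Fin n) → unitInterval) (A B : Finset (Fin n)) (q c : Fin n) (j : ℕ), C n w A →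
      (∀ (n' : ℕ) (w' : Sym2 (Fin n') → unitInterval) (A' B' : Finset (Fin n')) (q' c' : Fin n') (j' : ℕ),
        ((Finset.univ.filter fun e : Sym2 (Fin n') => w' e ≠ 0).card < (Finset.univ.filter fun e : Sym2 (Fin n) => w e ≠ 0).card ∨
          ((Finset.univ.filter fun e : Sym2 (Fin n') => w' e ≠ 0).card ≤ (Finset.univ.filter fun e : Sym2 (Fin n) => w e ≠ 0).card ∧ B'.card < B.card)) →
        C n' w' A' → q' ∈ A' → c' ∈ A' → B'.Nonempty → (∀ y ∈ B', y ∉ A') →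
        (∀ a ∈ A', (prodBernoulli w').real {ω : BondConfig (Fin n') | (A'.filter fun x => ω ∈ openConn a x).card ≤ j'} ≤
          (prodBernoulli w').real {ω : BondConfig (Fin n') | (A'.filter fun x => ω ∈ openConn q' x).card ≤ j'}) →
        (prodBernoulli w').real {ω : BondConfig (Fin n') | (∀ y ∈ B', ω ∉ openConn q' y) ∧
              1 ≤ (A'.filter fun z => ∃ y ∈ B', ω ∈ openConn y z).card ∧ (A'.filter fun z => ∃ y ∈ B', ω ∈ openConn y z).card ≤ j'} +
          (prodBernoulli w').real {ω : BondConfig (Fin n') | ¬ 1 ≤ (A'.filter fun z => ∃ y ∈ B', ω ∈ openConn y z).card ∧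
              (A'.filter fun z => ω ∈ openConn c' z).card ≤ j'} ≤ (prodBernoulli w').real {ω : BondConfig (Fin n') |
            (∀ y ∈ B', ω ∉ openConn q' y) ∧ (A'.filter fun z => ω ∈ openConn q' z).card ≤ j'}) → q ∈ A → c ∈ A → 2 ≤ B.card → (∀ y ∈ B, y ∉ A) →
      (∀ a ∈ A, (prodBernoulli w).real {ω : BondConfig (Fin n) | (A.filter fun x => ω ∈ openConn a x).card ≤ j} ≤
        (prodBernoulli w).real {ω : BondConfig (Fin n) | (A.filter fun x => ω ∈ openConn q x).card ≤ j}) →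
      (∀ y ∈ B, (prodBernoulli w).real {ω : BondConfig (Fin n) | (A.filter fun x => ω ∈ openConn q x).card ≤ j} <
        (prodBernoulli w).real {ω : BondConfig (Fin n) | (A.filter fun x => ω ∈ openConn y x).card ≤ j}) →
      (prodBernoulli w).real {ω : BondConfig (Fin n) | (∀ y ∈ B, ω ∉ openConn q y) ∧ 1 ≤ (A.filter fun z => ∃ y ∈ B, ω ∈ openConn y z).card ∧
            (A.filter fun z => ∃ y ∈ B, ω ∈ openConn y z).card ≤ j} + (prodBernoulli w).real {ω : BondConfig (Fin n) |
          ¬ 1 ≤ (A.filter fun z => ∃ y ∈ B, ω ∈ openConn y z).card ∧ (A.filter fun z => ω ∈ openConn c z).card ≤ j} ≤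
      (prodBernoulli w).real {ω : BondConfig (Fin n) | (∀ y ∈ B, ω ∉ openConn q y) ∧ (A.filter fun z => ω ∈ openConn q z).card ≤ j}) :
    ∀ (m b : ℕ) (n : ℕ) (w : Sym2 (Fin n) → unitInterval) (A B : Finset (Fin n)) (q c : Fin n) (j : ℕ),
      (Finset.univ.filter fun e : Sym2 (Fin n) => w e ≠ 0).card ≤ m → B.card ≤ b → C n w A → q ∈ A → c ∈ A → B.Nonempty → (∀ y ∈ B, y ∉ A) →
      (∀ a ∈ A, (prodBernoulli w).real {ω : BondConfig (Fin n) | (A.filter fun x => ω ∈ openConn a x).card ≤ j} ≤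
        (prodBernoulli w).real {ω : BondConfig (Fin n) | (A.filter fun x => ω ∈ openConn q x).card ≤ j}) →
      (prodBernoulli w).real {ω : BondConfig (Fin n) | (∀ y ∈ B, ω ∉ openConn q y) ∧ 1 ≤ (A.filter fun z => ∃ y ∈ B, ω ∈ openConn y z).card ∧
            (A.filter fun z => ∃ y ∈ B, ω ∈ openConn y z).card ≤ j} + (prodBernoulli w).real {ω : BondConfig (Fin n) |
          ¬ 1 ≤ (A.filter fun z => ∃ y ∈ B, ω ∈ openConn y z).card ∧ (A.filter fun z => ω ∈ openConn c z).card ≤ j} ≤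
      (prodBernoulli w).real {ω : BondConfig (Fin n) | (∀ y ∈ B, ω ∉ openConn q y) ∧ (A.filter fun z => ω ∈ openConn q z).card ≤ j} := by
  intro m
  induction m with
  | zero =>
    intro b
    induction b with
    | zero =>
      intro n w A B q c j hm hb hCw hq hc hBne hBA hchamp
      exact absurd (Finset.card_pos.2 hBne) (by omega)
    | succ b ihb =>
      intro n w A B q c j hm hb hCw hq hc hBne hBA hchamp
      exact step n w A B q c j hCw hq hc hBne hBA hchamp
        (fun n' w' A' B' q' c' j' hlt => by
          rcases hlt with hlt | ⟨hle, hcard⟩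
          · exact absurd hlt (by omega)
          · exact ihb n' w' A' B' q' c' j' (by omega) (by omega))
  | succ m ihm =>
    intro b
    induction b with
    | zero =>
      intro n w A B q c j hm hb hCw hq hc hBne hBA hchamp
      exact absurd (Finset.card_pos.2 hBne) (by omega)
    | succ b ihb =>
      intro n w A B q c j hm hb hCw hq hc hBne hBA hchamp
      exact step n w A B q c j hCw hq hc hBne hBA hchamp
        (fun n' w' A' B' q' c' j' hlt => by
          rcases hlt with hlt | ⟨hle, hcard⟩
          · exact ihm B'.card n' w' A' B' q' c' j' (by omega) le_rfl
          · exact ihb n' w' A' B' q' c' j' (by omega) (by omega))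
  where
  /- the induction step, with the induction hypothesis available for every graph with FEWER positive pairs (any set) and for
  every SMALLER set in graphs with at most as many positive pairs -/
  step (n : ℕ) (w : Sym2 (Fin n) → unitInterval) (A B : Finset (Fin n)) (q c : Fin n) (j : ℕ)
      (hCw : C n w A) (hq : q ∈ A) (hc : c ∈ A) (hBne : B.Nonempty) (hBA : ∀ y ∈ B, y ∉ A)
      (hchamp : ∀ a ∈ A, (prodBernoulli w).real {ω : BondConfig (Fin n) | (A.filter fun x => ω ∈ openConn a x).card ≤ j} ≤
        (prodBernoulli w).real {ω : BondConfig (Fin n) | (A.filter fun x => ω ∈ openConn q x).card ≤ j})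
      (ih : ∀ (n' : ℕ) (w' : Sym2 (Fin n') → unitInterval) (A' B' : Finset (Fin n')) (q' c' : Fin n') (j' : ℕ),
        ((Finset.univ.filter fun e : Sym2 (Fin n') => w' e ≠ 0).card < (Finset.univ.filter fun e : Sym2 (Fin n) => w e ≠ 0).card ∨
          ((Finset.univ.filter fun e : Sym2 (Fin n') => w' e ≠ 0).card ≤ (Finset.univ.filter fun e : Sym2 (Fin n) => w e ≠ 0).card ∧ B'.card < B.card)) →
        C n' w' A' → q' ∈ A' → c' ∈ A' → B'.Nonempty → (∀ y ∈ B', y ∉ A') →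
        (∀ a ∈ A', (prodBernoulli w').real {ω : BondConfig (Fin n') | (A'.filter fun x => ω ∈ openConn a x).card ≤ j'} ≤
          (prodBernoulli w').real {ω : BondConfig (Fin n') | (A'.filter fun x => ω ∈ openConn q' x).card ≤ j'}) →
        (prodBernoulli w').real {ω : BondConfig (Fin n') | (∀ y ∈ B', ω ∉ openConn q' y) ∧
              1 ≤ (A'.filter fun z => ∃ y ∈ B', ω ∈ openConn y z).card ∧ (A'.filter fun z => ∃ y ∈ B', ω ∈ openConn y z).card ≤ j'} +
          (prodBernoulli w').real {ω : BondConfig (Fin n') | ¬ 1 ≤ (A'.filter fun z => ∃ y ∈ B', ω ∈ openConn y z).card ∧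
              (A'.filter fun z => ω ∈ openConn c' z).card ≤ j'} ≤ (prodBernoulli w').real {ω : BondConfig (Fin n') |
            (∀ y ∈ B', ω ∉ openConn q' y) ∧ (A'.filter fun z => ω ∈ openConn q' z).card ≤ j'}) : (prodBernoulli w).real {ω : BondConfig (Fin n) |
          (∀ y ∈ B, ω ∉ openConn q y) ∧ 1 ≤ (A.filter fun z => ∃ y ∈ B, ω ∈ openConn y z).card ∧
            (A.filter fun z => ∃ y ∈ B, ω ∈ openConn y z).card ≤ j} + (prodBernoulli w).real {ω : BondConfig (Fin n) |
          ¬ 1 ≤ (A.filter fun z => ∃ y ∈ B, ω ∈ openConn y z).card ∧ (A.filter fun z => ω ∈ openConn c z).card ≤ j} ≤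
      (prodBernoulli w).real {ω : BondConfig (Fin n) | (∀ y ∈ B, ω ∉ openConn q y) ∧ (A.filter fun z => ω ∈ openConn q z).card ≤ j} := by
    haveI : IsProbabilityMeasure (prodBernoulli w) := inferInstance
    set μ := prodBernoulli w with hμ
    -- notation for the `w`-counts
    set NB : BondConfig (Fin n) → ℕ := fun ω => (A.filter fun z => ∃ y ∈ B, ω ∈ openConn y z).card with hNB
    set Nx : Fin n → BondConfig (Fin n) → ℕ := fun x ω => (A.filter fun z => ω ∈ openConn x z).card with hNx
    change μ.real {ω | (∀ y ∈ B, ω ∉ openConn q y) ∧ 1 ≤ NB ω ∧ NB ω ≤ j} + μ.real {ω | ¬ 1 ≤ NB ω ∧ Nx c ω ≤ j} ≤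
      μ.real {ω | (∀ y ∈ B, ω ∉ openConn q y) ∧ Nx q ω ≤ j}
    have hfilt : ∀ (x : Fin n) (ξ : BondConfig (Fin n)), (A.filter fun z => (openGraph ξ).Reachable x z) = (A.filter fun z => ξ ∈ openConn x z) :=
      fun x ξ => Finset.filter_congr fun _ _ => Iff.rfl
    have hfiltB : ∀ (ξ : BondConfig (Fin n)), (A.filter fun z => ∃ y ∈ B, (openGraph ξ).Reachable y z) = (A.filter fun z => ∃ y ∈ B, ξ ∈ openConn y z) :=
      fun ξ => Finset.filter_congr fun _ _ => Iff.rfl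
    -- `|π(B)| = 0` forces `q ≁ B` (`q` is a relay)
    have hNB0 : ∀ ω, ¬ 1 ≤ NB ω → ∀ y ∈ B, ω ∉ openConn q y := by
      intro ω h y hy hqy
      refine h (Finset.card_pos.2 ⟨q, Finset.mem_filter.2 ⟨hq, y, hy, ?_⟩⟩)
      exact (show (openGraph ω).Reachable q y from hqy).symm
    by_cases hdm : ∃ y ∈ B, μ.real {ω : BondConfig (Fin n) | (A.filter fun x => ω ∈ openConn y x).card ≤ j} ≤
        μ.real {ω : BondConfig (Fin n) | (A.filter fun x => ω ∈ openConn q x).card ≤ j}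
    · -- #### a member no lighter than the champion: unguarded stability in `w` itself
      obtain ⟨y, hyB, hy⟩ := hdm
      have hqy : q ≠ y := fun h => hBA y hyB (h ▸ hq)
      have hle : μ.real {ω : BondConfig (Fin n) | (A.filter fun z => (openGraph ω).Reachable y z).card ≤ j} ≤
          μ.real {ω : BondConfig (Fin n) | (A.filter fun z => (openGraph ω).Reachable q z).card ≤ j} := by
        have e1 : {ω : BondConfig (Fin n) | (A.filter fun z => (openGraph ω).Reachable y z).card ≤ j} =
            {ω : BondConfig (Fin n) | (A.filter fun x => ω ∈ openConn y x).card ≤ j} := by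
          ext ω; simp only [mem_setOf_eq, hfilt y ω]
        have e2 : {ω : BondConfig (Fin n) | (A.filter fun z => (openGraph ω).Reachable q z).card ≤ j} =
            {ω : BondConfig (Fin n) | (A.filter fun x => ω ∈ openConn q x).card ≤ j} := by
          ext ω; simp only [mem_setOf_eq, hfilt q ω]
        rw [e1, e2]; exact hy
      have key := unguardedStability_of_member w A B hyB hqy j hle
      have ek1 : {ω : BondConfig (Fin n) | (∀ m ∈ B, ¬ (openGraph ω).Reachable q m) ∧
            (A.filter fun z => ∃ x ∈ B, (openGraph ω).Reachable x z).card ≤ j} = {ω | (∀ y ∈ B, ω ∉ openConn q y) ∧ NB ω ≤ j} := by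
        ext ω; simp only [mem_setOf_eq, hNB, hfiltB ω]; exact Iff.rfl
      have ek2 : {ω : BondConfig (Fin n) | (∀ m ∈ B, ¬ (openGraph ω).Reachable q m) ∧ (A.filter fun z => (openGraph ω).Reachable q z).card ≤ j} =
          {ω | (∀ y ∈ B, ω ∉ openConn q y) ∧ Nx q ω ≤ j} := by
        ext ω; simp only [mem_setOf_eq, hNx, hfilt q ω]; exact Iff.rfl
      rw [ek1, ek2] at key
      -- the two left events are disjoint pieces of `{q ≁ B, |π(B)| ≤ j}`
      have hdisj : Disjoint {ω | (∀ y ∈ B, ω ∉ openConn q y) ∧ 1 ≤ NB ω ∧ NB ω ≤ j} {ω | ¬ 1 ≤ NB ω ∧ Nx c ω ≤ j} := by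
        rw [Set.disjoint_left]
        rintro ω ⟨_, h1, _⟩ ⟨h2, _⟩
        exact h2 h1
      have hsub : {ω | (∀ y ∈ B, ω ∉ openConn q y) ∧ 1 ≤ NB ω ∧ NB ω ≤ j} ∪ {ω | ¬ 1 ≤ NB ω ∧ Nx c ω ≤ j} ⊆ {ω | (∀ y ∈ B, ω ∉ openConn q y) ∧ NB ω ≤ j} := by
        rintro ω (⟨h1, _, h3⟩ | ⟨h1, _⟩)
        · exact ⟨h1, h3⟩
        · exact ⟨hNB0 ω h1, by show NB ω ≤ j; omega⟩
      have hu' := measureReal_union hdisj (MeasurableSet.of_discrete (s := {ω | ¬ 1 ≤ NB ω ∧ Nx c ω ≤ j})) (μ := μ)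
        (measure_ne_top _ _) (measure_ne_top _ _)
      rw [← hu']
      exact (measureReal_mono hsub (measure_ne_top _ _)).trans key
    -- all members are strictly lighter than `q`
    push Not at hdm
    by_cases hcard : 2 ≤ B.card
    · -- #### a LIGHT MULTI-SET: the gluing hypothesis (with the full induction hypothesis)
      exact hGlue n w A B q c j hCw ih hq hc hcard hBA hchamp hdm
    -- #### a light SINGLETON `B = {o}`: the deficit star-packing transfer at the observer `o`
    obtain ⟨o, hoB⟩ := hBne
    have hB1 : B = {o} := by
      have hc1 : B.card = 1 := by
        have := Finset.card_pos.2 ⟨o, hoB⟩; omega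
      obtain ⟨o', ho'⟩ := Finset.card_eq_one.1 hc1
      rw [ho'] at hoB ⊢; rw [Finset.mem_singleton.1 hoB]
    subst hB1
    have ho : o ∉ A := hBA o hoB
    -- `|π({o})| = |π(o)|`
    have hNo : ∀ ω, NB ω = Nx o ω := by
      intro ω
      simp only [hNB, hNx]
      congr 1
      refine Finset.filter_congr fun z _ => ⟨fun ⟨x, hx, hxz⟩ => ?_, fun h => ⟨o, Finset.mem_singleton_self o, h⟩⟩
      rw [Finset.mem_singleton.1 hx] at hxz; exact hxz
    -- ### the unrestricted deficit form `μ(1 ≤ N ≤ j) + Φ(c) ≤ μ(Φ_c ∩ 𝔸) + Φ(q)` (the step of `xzDeficit_induction_open`)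
    have hXZ : μ.real {ω : BondConfig (Fin n) | 1 ≤ Nx o ω ∧ Nx o ω ≤ j} + μ.real {ω : BondConfig (Fin n) | Nx c ω ≤ j} ≤
        μ.real {ω : BondConfig (Fin n) | Nx c ω ≤ j ∧ 1 ≤ Nx o ω} + μ.real {ω : BondConfig (Fin n) | Nx q ω ≤ j} := by
      set L := {ω : BondConfig (Fin n) | 1 ≤ Nx o ω ∧ Nx o ω ≤ j} with hL
      set RcA := {ω : BondConfig (Fin n) | Nx c ω ≤ j ∧ 1 ≤ Nx o ω} with hRcA
      set sW : Fin n → ℝ := fun y => μ.real {ω : BondConfig (Fin n) | (A.filter fun z => (openGraph (ω ∩ {e | o ∉ e})).Reachable y z).card ≤ j} with hsW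
      set Γ : Finset (Fin n) := Finset.univ.filter fun v => v ≠ o ∧ w s(o, v) ≠ 0 with hΓ
      have hΓo : o ∉ Γ := by
        rw [hΓ, Finset.mem_filter]; exact fun h => h.2.1 rfl
      have hiso : ∀ v, v ≠ o → v ∉ Γ → w s(o, v) = 0 := by
        intro v hvo hvΓ
        by_contra hne
        exact hvΓ (Finset.mem_filter.2 ⟨Finset.mem_univ _, hvo, hne⟩)
      by_cases hΓe : Γ = ∅
      · -- #### no gate: `L` is null
        have hdecL := real_eq_sum_inter_starEvent w Γ o hΓo hiso L
        rw [hΓe, Finset.powerset_empty, Finset.sum_singleton] at hdecL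
        have h0 : L ∩ starEvent o ↑(∅ : Finset (Fin n)) = (∅ : Set (BondConfig (Fin n))) := by
          ext ω
          simp only [mem_inter_iff, mem_empty_iff_false, iff_false, not_and]
          intro hLω hσ
          rw [Finset.coe_empty] at hσ
          obtain ⟨x, hx⟩ := Finset.card_pos.1 (lt_of_lt_of_le Nat.zero_lt_one hLω.1)
          rw [Finset.mem_filter] at hx
          exact not_reachable_of_mem_starEvent_empty hσ (fun h => ho (h ▸ hx.1)) hx.2
        rw [h0, measureReal_empty] at hdecL
        have hRcA0 : 0 ≤ μ.real RcA := measureReal_nonneg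
        rw [hdecL]
        linarith [hchamp c hc]
      -- #### a gate exists: the weights `u` without the pairs at `o` have fewer positive pairs
      obtain ⟨y₀, hy₀⟩ := Finset.nonempty_iff_ne_empty.2 hΓe
      have hy₀' := Finset.mem_filter.1 hy₀
      set u : Sym2 (Fin n) → unitInterval := fun e => if e ∈ {e : Sym2 (Fin n) | o ∉ e} then w e else 0 with hu
      have hCu : C n u A := hC n w A o hCw
      have hlt : (Finset.univ.filter fun e : Sym2 (Fin n) => u e ≠ 0).card < (Finset.univ.filter fun e : Sym2 (Fin n) => w e ≠ 0).card := by
        refine Finset.card_lt_card ⟨fun e he => ?_, fun hsub => ?_⟩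
        · rw [Finset.mem_filter] at he ⊢
          refine ⟨he.1, fun hwe => he.2 ?_⟩
          simp only [hu, mem_setOf_eq]
          split_ifs <;> simp [hwe]
        · have hmem : s(o, y₀) ∈ (Finset.univ.filter fun e : Sym2 (Fin n) => w e ≠ 0) :=
            Finset.mem_filter.2 ⟨Finset.mem_univ _, hy₀'.2.2⟩
          have := Finset.mem_filter.1 (hsub hmem)
          apply this.2
          simp only [hu, mem_setOf_eq, Sym2.mem_iff, true_or, not_true_eq_false, if_false]
      -- transfer of `K`-events to `prodBernoulli u`
      have e1 : ∀ x : Fin n, {ω : BondConfig (Fin n) | (A.filter fun z => (openGraph (ω ∩ {e | o ∉ e})).Reachable x z).card ≤ j} =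
          {ω : BondConfig (Fin n) | ω ∩ {e | o ∉ e} ∈ {ξ : BondConfig (Fin n) | (A.filter fun z => (openGraph ξ).Reachable x z).card ≤ j}} := fun x => rfl
      have eoc : ∀ (x : Fin n), {ξ : BondConfig (Fin n) | (A.filter fun z => (openGraph ξ).Reachable x z).card ≤ j} =
          {ξ : BondConfig (Fin n) | (A.filter fun z => ξ ∈ openConn x z).card ≤ j} := by
        intro x; ext ξ
        exact ⟨fun h => by rw [mem_setOf_eq] at h ⊢; rwa [← hfilt x ξ], fun h => by rw [mem_setOf_eq] at h ⊢; rwa [hfilt x ξ]⟩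
      -- a champion `p` of `u`
      obtain ⟨p, hpA, hpmax⟩ := Finset.exists_max_image A sW ⟨q, hq⟩
      have hchampK : ∀ a ∈ A, (prodBernoulli u).real {ξ : BondConfig (Fin n) | (A.filter fun z => (openGraph ξ).Reachable a z).card ≤ j} ≤
            (prodBernoulli u).real {ξ : BondConfig (Fin n) | (A.filter fun z => (openGraph ξ).Reachable p z).card ≤ j} := by
        intro a ha
        have h := hpmax a ha
        simp only [hsW] at h
        rw [e1 a, e1 p, measureReal_preimage_avoid, measureReal_preimage_avoid] at h
        exact h
      have hchampK' : ∀ a ∈ A, (prodBernoulli u).real {ξ : BondConfig (Fin n) | (A.filter fun z => ξ ∈ openConn a z).card ≤ j} ≤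
            (prodBernoulli u).real {ξ : BondConfig (Fin n) | (A.filter fun z => ξ ∈ openConn p z).card ≤ j} := by
        intro a ha; rw [← eoc a, ← eoc p]; exact hchampK a ha
      -- ### the deficit star-packing transfer with reference `p`
      have hmain := starPacking_deficit w A o p c j ho hpA hc ?_ (hpmax c hc)
      · have hgoal : μ.real {ω : BondConfig (Fin n) | 1 ≤ (A.filter fun x => ω ∈ openConn o x).card ∧ (A.filter fun x => ω ∈ openConn o x).card ≤ j} +
            μ.real {ω : BondConfig (Fin n) | (A.filter fun z => ω ∈ openConn c z).card ≤ j} ≤ μ.real {ω : BondConfig (Fin n) |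
              (A.filter fun x => ω ∈ openConn c x).card ≤ j ∧ 1 ≤ (A.filter fun x => ω ∈ openConn o x).card} +
            μ.real {ω : BondConfig (Fin n) | (A.filter fun z => ω ∈ openConn q z).card ≤ j} :=
          le_trans hmain (by linarith [hchamp p hpA])
        exact hgoal
      -- ### the packing inequality at every nonempty star: the induction hypothesis in `u` (any star size)
      intro S hSne hS
      have eP1 : {ω : BondConfig (Fin n) | (∀ y ∈ S, ¬ (openGraph (ω ∩ {e | o ∉ e})).Reachable p y) ∧
              1 ≤ (A.filter fun z => ∃ y ∈ S, (openGraph (ω ∩ {e | o ∉ e})).Reachable y z).card ∧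
              (A.filter fun z => ∃ y ∈ S, (openGraph (ω ∩ {e | o ∉ e})).Reachable y z).card ≤ j} =
          {ω : BondConfig (Fin n) | ω ∩ {e | o ∉ e} ∈ {ξ : BondConfig (Fin n) | (∀ y ∈ S, ¬ (openGraph ξ).Reachable p y) ∧
              1 ≤ (A.filter fun z => ∃ y ∈ S, (openGraph ξ).Reachable y z).card ∧ (A.filter fun z => ∃ y ∈ S, (openGraph ξ).Reachable y z).card ≤ j}} := rfl
      have eP2 : {ω : BondConfig (Fin n) | ¬ 1 ≤ (A.filter fun z => ∃ y ∈ S, (openGraph (ω ∩ {e | o ∉ e})).Reachable y z).card ∧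
              (A.filter fun z => (openGraph (ω ∩ {e | o ∉ e})).Reachable c z).card ≤ j} =
          {ω : BondConfig (Fin n) | ω ∩ {e | o ∉ e} ∈ {ξ : BondConfig (Fin n) |
            ¬ 1 ≤ (A.filter fun z => ∃ y ∈ S, (openGraph ξ).Reachable y z).card ∧ (A.filter fun z => (openGraph ξ).Reachable c z).card ≤ j}} := rfl
      have eP3 : {ω : BondConfig (Fin n) | (∀ y ∈ S, ¬ (openGraph (ω ∩ {e | o ∉ e})).Reachable p y) ∧
              (A.filter fun z => (openGraph (ω ∩ {e | o ∉ e})).Reachable p z).card ≤ j} =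
          {ω : BondConfig (Fin n) | ω ∩ {e | o ∉ e} ∈ {ξ : BondConfig (Fin n) | (∀ y ∈ S, ¬ (openGraph ξ).Reachable p y) ∧
              (A.filter fun z => (openGraph ξ).Reachable p z).card ≤ j}} := rfl
      rw [eP1, eP2, eP3, measureReal_preimage_avoid, measureReal_preimage_avoid, measureReal_preimage_avoid]
      set ν := prodBernoulli u with hν
      haveI : IsProbabilityMeasure ν := inferInstance
      set MS : BondConfig (Fin n) → ℕ := fun ξ => (A.filter fun z => ∃ y ∈ S, (openGraph ξ).Reachable y z).card with hMS
      set Lx : Fin n → BondConfig (Fin n) → ℕ := fun x ξ => (A.filter fun z => (openGraph ξ).Reachable x z).card with hLx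
      change ν.real {ξ | (∀ y ∈ S, ¬ (openGraph ξ).Reachable p y) ∧ 1 ≤ MS ξ ∧ MS ξ ≤ j} +
          ν.real {ξ | ¬ 1 ≤ MS ξ ∧ Lx c ξ ≤ j} ≤ ν.real {ξ | (∀ y ∈ S, ¬ (openGraph ξ).Reachable p y) ∧ Lx p ξ ≤ j}
      have hMS0 : ∀ ξ, ¬ 1 ≤ MS ξ → ∀ y ∈ S, ¬ (openGraph ξ).Reachable p y := by
        intro ξ h y hy hpy
        exact h (Finset.card_pos.2 ⟨p, Finset.mem_filter.2 ⟨hpA, y, hy, hpy.symm⟩⟩)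
      by_cases hpS : p ∈ S
      · -- `p ∈ S`: `p ≁ S` is impossible and `|π(S)| ≥ 1`
        have h1 : ν.real {ξ | (∀ y ∈ S, ¬ (openGraph ξ).Reachable p y) ∧ 1 ≤ MS ξ ∧ MS ξ ≤ j} = 0 := by
          have : {ξ | (∀ y ∈ S, ¬ (openGraph ξ).Reachable p y) ∧ 1 ≤ MS ξ ∧ MS ξ ≤ j} = (∅ : Set (BondConfig (Fin n))) := by
            ext ξ; simp only [mem_setOf_eq, mem_empty_iff_false, iff_false, not_and]
            intro h; exact absurd (SimpleGraph.Reachable.refl p) (h p hpS)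
          rw [this, measureReal_empty]
        have h2 : ν.real {ξ | ¬ 1 ≤ MS ξ ∧ Lx c ξ ≤ j} = 0 := by
          have : {ξ | ¬ 1 ≤ MS ξ ∧ Lx c ξ ≤ j} = (∅ : Set (BondConfig (Fin n))) := by
            ext ξ; simp only [mem_setOf_eq, mem_empty_iff_false, iff_false, not_and]
            intro h; exact absurd (SimpleGraph.Reachable.refl p) (hMS0 ξ h p hpS)
          rw [this, measureReal_empty]
        rw [h1, h2, add_zero]; exact measureReal_nonneg
      by_cases hdmS : ∃ y ∈ S, sW y ≤ sW p
      · -- #### a member no `u`-lighter than `p`: unguarded stability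
        obtain ⟨y, hyS, hy⟩ := hdmS
        have hpy : p ≠ y := fun h => hpS (h ▸ hyS)
        have hle : ν.real {ξ : BondConfig (Fin n) | (A.filter fun z => (openGraph ξ).Reachable y z).card ≤ j} ≤
            ν.real {ξ : BondConfig (Fin n) | (A.filter fun z => (openGraph ξ).Reachable p z).card ≤ j} := by
          have h := hy
          simp only [hsW] at h
          rw [e1 y, e1 p, measureReal_preimage_avoid, measureReal_preimage_avoid] at h
          exact h
        have key := unguardedStability_of_member u A S hyS hpy j hle
        change ν.real {ξ | (∀ m ∈ S, ¬ (openGraph ξ).Reachable p m) ∧ MS ξ ≤ j} ≤ ν.real {ξ | (∀ m ∈ S, ¬ (openGraph ξ).Reachable p m) ∧ Lx p ξ ≤ j} at key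
        have hdisj : Disjoint {ξ | (∀ y ∈ S, ¬ (openGraph ξ).Reachable p y) ∧ 1 ≤ MS ξ ∧ MS ξ ≤ j} {ξ | ¬ 1 ≤ MS ξ ∧ Lx c ξ ≤ j} := by
          rw [Set.disjoint_left]
          rintro ξ ⟨_, h1, _⟩ ⟨h2, _⟩
          exact h2 h1
        have hsub : {ξ | (∀ y ∈ S, ¬ (openGraph ξ).Reachable p y) ∧ 1 ≤ MS ξ ∧ MS ξ ≤ j} ∪
            {ξ | ¬ 1 ≤ MS ξ ∧ Lx c ξ ≤ j} ⊆ {ξ | (∀ m ∈ S, ¬ (openGraph ξ).Reachable p m) ∧ MS ξ ≤ j} := by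
          rintro ξ (⟨h1, _, h3⟩ | ⟨h1, _⟩)
          · exact ⟨h1, h3⟩
          · exact ⟨hMS0 ξ h1, by show MS ξ ≤ j; omega⟩
        have hu' := measureReal_union hdisj (MeasurableSet.of_discrete (s := {ξ | ¬ 1 ≤ MS ξ ∧ Lx c ξ ≤ j})) (μ := ν)
          (measure_ne_top _ _) (measure_ne_top _ _)
        rw [← hu']
        exact (measureReal_mono hsub (measure_ne_top _ _)).trans key
      · -- #### a LIGHT star of `o` (all members non-relays `u`-lighter than `p`): the induction hypothesis in `u`, ANY size
        push Not at hdmS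
        have hSA : ∀ y ∈ S, y ∉ A := by
          intro y hy hyA
          exact absurd (hpmax y hyA) (not_le.2 (hdmS y hy))
        have hIH := ih n u A S p c j (Or.inl hlt) hCu hpA hc hSne hSA hchampK'
        -- rewrite the IH in `Reachable` form
        have hfiltS : ∀ (ξ : BondConfig (Fin n)), (A.filter fun z => ∃ y ∈ S, (openGraph ξ).Reachable y z) = (A.filter fun z => ∃ y ∈ S, ξ ∈ openConn y z) :=
          fun ξ => Finset.filter_congr fun _ _ => Iff.rfl
        have eL : {ξ : BondConfig (Fin n) | (∀ y ∈ S, ξ ∉ openConn p y) ∧ 1 ≤ (A.filter fun z => ∃ y ∈ S, ξ ∈ openConn y z).card ∧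
              (A.filter fun z => ∃ y ∈ S, ξ ∈ openConn y z).card ≤ j} = {ξ | (∀ y ∈ S, ¬ (openGraph ξ).Reachable p y) ∧ 1 ≤ MS ξ ∧ MS ξ ≤ j} := by
          ext ξ; simp only [mem_setOf_eq, hMS, hfiltS ξ]; exact Iff.rfl
        have eZ : {ξ : BondConfig (Fin n) | ¬ 1 ≤ (A.filter fun z => ∃ y ∈ S, ξ ∈ openConn y z).card ∧
              (A.filter fun z => ξ ∈ openConn c z).card ≤ j} = {ξ | ¬ 1 ≤ MS ξ ∧ Lx c ξ ≤ j} := by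
          ext ξ; simp only [mem_setOf_eq, hMS, hLx, hfiltS ξ, hfilt c ξ]
        have eR : {ξ : BondConfig (Fin n) | (∀ y ∈ S, ξ ∉ openConn p y) ∧ (A.filter fun z => ξ ∈ openConn p z).card ≤ j} =
            {ξ | (∀ y ∈ S, ¬ (openGraph ξ).Reachable p y) ∧ Lx p ξ ≤ j} := by
          ext ξ; simp only [mem_setOf_eq, hLx, hfilt p ξ]; exact Iff.rfl
        rw [eL, eZ, eR] at hIH
        exact hIH
    -- ### from the unrestricted deficit form to LSP(w, q, c, {o}): on `{q ↔ o}` both sides carry the same mass `μ(q ↔ o, Φ_q)`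
    have hsplit := measureReal_inter_add_sdiff (μ := μ) (s := {ω : BondConfig (Fin n) | Nx c ω ≤ j})
      (MeasurableSet.of_discrete (s := {ω : BondConfig (Fin n) | 1 ≤ Nx o ω})) (measure_ne_top _ _)
    have es1 : {ω : BondConfig (Fin n) | Nx c ω ≤ j} ∩ {ω | 1 ≤ Nx o ω} = {ω | Nx c ω ≤ j ∧ 1 ≤ Nx o ω} := by
      ext ω; simp only [mem_inter_iff, mem_setOf_eq]
    have es2 : {ω : BondConfig (Fin n) | Nx c ω ≤ j} \ {ω | 1 ≤ Nx o ω} = {ω | ¬ 1 ≤ NB ω ∧ Nx c ω ≤ j} := by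
      ext ω; simp only [mem_sdiff, mem_setOf_eq, hNo]; exact and_comm
    rw [es1, es2] at hsplit
    have hsplitL := measureReal_inter_add_sdiff (μ := μ) (s := {ω : BondConfig (Fin n) | 1 ≤ Nx o ω ∧ Nx o ω ≤ j})
      (MeasurableSet.of_discrete (s := {ω : BondConfig (Fin n) | ω ∈ openConn q o})) (measure_ne_top _ _)
    have hsplitR := measureReal_inter_add_sdiff (μ := μ) (s := {ω : BondConfig (Fin n) | Nx q ω ≤ j})
      (MeasurableSet.of_discrete (s := {ω : BondConfig (Fin n) | ω ∈ openConn q o})) (measure_ne_top _ _)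
    have hNq_eq : ∀ ω : BondConfig (Fin n), ω ∈ openConn q o → Nx q ω = Nx o ω := by
      intro ω hqo
      have hqo' : (openGraph ω).Reachable q o := hqo
      simp only [hNx]
      congr 1
      refine Finset.filter_congr fun z _ => ⟨fun h => ?_, fun h => ?_⟩
      · exact (show (openGraph ω).Reachable o z from hqo'.symm.trans h)
      · exact (show (openGraph ω).Reachable q z from hqo'.trans h)
    have hNo1 : ∀ ω : BondConfig (Fin n), ω ∈ openConn q o → 1 ≤ Nx o ω := by
      intro ω hqo
      have hqo' : (openGraph ω).Reachable q o := hqo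
      exact Finset.card_pos.2 ⟨q, Finset.mem_filter.2 ⟨hq, (show ω ∈ openConn o q from hqo'.symm)⟩⟩
    have eV : {ω : BondConfig (Fin n) | 1 ≤ Nx o ω ∧ Nx o ω ≤ j} ∩ {ω | ω ∈ openConn q o} =
        {ω : BondConfig (Fin n) | Nx q ω ≤ j} ∩ {ω | ω ∈ openConn q o} := by
      ext ω
      simp only [mem_inter_iff, mem_setOf_eq]
      constructor
      · rintro ⟨⟨_, h2⟩, h3⟩; exact ⟨by rw [hNq_eq ω h3]; exact h2, h3⟩
      · rintro ⟨h2, h3⟩; exact ⟨⟨hNo1 ω h3, by rw [← hNq_eq ω h3]; exact h2⟩, h3⟩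
    have eDL : {ω : BondConfig (Fin n) | 1 ≤ Nx o ω ∧ Nx o ω ≤ j} \ {ω | ω ∈ openConn q o} =
        {ω | (∀ y ∈ ({o} : Finset (Fin n)), ω ∉ openConn q y) ∧ 1 ≤ NB ω ∧ NB ω ≤ j} := by
      ext ω
      simp only [mem_sdiff, mem_setOf_eq, Finset.mem_singleton, forall_eq, hNo]
      tauto
    have eDR : {ω : BondConfig (Fin n) | Nx q ω ≤ j} \ {ω | ω ∈ openConn q o} = {ω | (∀ y ∈ ({o} : Finset (Fin n)), ω ∉ openConn q y) ∧ Nx q ω ≤ j} := by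
      ext ω
      simp only [mem_sdiff, mem_setOf_eq, Finset.mem_singleton, forall_eq]
      tauto
    rw [eV, eDL] at hsplitL
    rw [eDR] at hsplitR
    have hXZ' : μ.real {ω : BondConfig (Fin n) | 1 ≤ Nx o ω ∧ Nx o ω ≤ j} + μ.real {ω : BondConfig (Fin n) | Nx c ω ≤ j} ≤
        μ.real {ω : BondConfig (Fin n) | Nx c ω ≤ j ∧ 1 ≤ Nx o ω} + μ.real {ω : BondConfig (Fin n) | Nx q ω ≤ j} := hXZ
    linarith


end Summit.CriticalPhenomena.PercolationContinuityZ3.Theorems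

end
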